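import Literature.NumberTheory.EllipticCurves.CuspClassHeckeAnnihilationProofs
import HarnessLib

/-!
# Twisted symbol sums off the level gcd are `Γ₁(N)`-integral: `Σ_a χ(a){∞, a/m}_f ∈ ℤ[χ]·Λ₁(f)` (THM 93.C, Manin-free)

[Proofs] Theorems only (no definition, no named fact, no sorry).  Namespace
`Literature.NumberTheory.EllipticCurves.ModularForms`; uses the class lemma of `CuspClassHeckeAnnihilationProofs.lean`
(`modularSymbol_sub_mem_periodLatticeGamma1_of_congr`, Diamond–Shurman Prop. 3.8.3 + Manin).

THE STATEMENT (E-es-364 `TwistedSymbolSumIntegralOffGcd` of MEMO-es §93.4, typed verbatim in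
`pub/bsd-f2-manin/es/g64/Sketch-es-g64.lean`; proved here as `twistedSymbolSumIntegralOffGcd`): for `f ∈ S₂(Γ₀(N))`, `m ≥ 1`
and a Dirichlet character `χ mod m` that does NOT factor through `(ℤ/gcd(m, N))^×`:
`twistedSymbolSum f χ = Σ_{a mod m} χ(a)·{∞, a/m}_f ∈ ℤ[χ]·Λ₁(f)` (the `ℤ`-span of the products `χ(c)·w`, `w ∈ Λ₁(f)`).
This is Wiersema–Wuthrich 2022, Prop. 8, at the level of `f`-periods, where no Manin constant occurs (their hypothesis
`c₁ = 1` only moves `Γ₁(N)`-periods into the Néron lattice).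
PROOF (§93.4): with `δ = gcd(m, N)`, `π : (ℤ/m)^× → (ℤ/δ)^×`, `K = ker π` and a section `s` of `π`: the symbol
`{∞, u/m}_f` modulo `Λ₁(f)` depends only on `π(u)` (class lemma), so
`Σ_u χ(u){∞, u/m} = Σ_u χ(u){∞, s(πu)/m} + Σ_u χ(u)·w_u` with `w_u ∈ Λ₁(f)`, and the first sum is
`Σ_v {∞, s(v)/m}·χ(s v)·Σ_{k∈K} χ(k) = 0` because `χ|_K ≠ 1` (`¬ FactorsThrough` = Mathlib's `factorsThrough_iff_ker_unitsMap`).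

## References
* [WiersemaWuthrich2022] G. Wiersema, C. Wuthrich, *Integrality of twisted L-values of elliptic curves*, Prop. 8 (p. 7).
* [DiamondShurman2005] F. Diamond, J. Shurman, *A first course in modular forms*, Prop. 3.8.3.
* [Manin1972] Ju. I. Manin, *Parabolic points and zeta functions of modular curves*, Thm. 1.6.
-/

noncomputable section

open scoped MatrixGroups ModularForm

open CongruenceSubgroup

namespace Literature.NumberTheory.EllipticCurves.ModularForms

variable {N : ℕ} [NeZero N] (f : CuspForm (Gamma0 N) 2)

/-! ### §1 The symbol `{∞, u/m}_f` modulo `Λ₁(f)` depends only on `u mod gcd(m, N)` (units `u`) -/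

/-- For units `u, u'` of `ℤ/m` with the same image in `ℤ/gcd(m, N)`: `{∞, u'/m}_f − {∞, u/m}_f ∈ Λ₁(f)`
(representatives `val ∈ [0, m)`).  [cite: DiamondShurman2005, Prop. 3.8.3 (PDF p. 120)] [cite: WiersemaWuthrich2022, proof of Prop. 8 (p. 7)] -/
theorem modularSymbol_units_sub_mem_periodLatticeGamma1 {m : ℕ} [NeZero m] (u u' : (ZMod m)ˣ)
    (h : ZMod.unitsMap (Nat.gcd_dvd_left m N) u' = ZMod.unitsMap (Nat.gcd_dvd_left m N) u) :
    modularSymbol f (((u' : ZMod m).val : ℚ) / m) - modularSymbol f (((u : ZMod m).val : ℚ) / m)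
      ∈ periodLatticeGamma1 f := by
  have hm0 : (m : ℤ) ≠ 0 := by exact_mod_cast (NeZero.ne m)
  have hcop : IsCoprime (((u : ZMod m).val : ℕ) : ℤ) (m : ℤ) :=
    Nat.isCoprime_iff_coprime.mpr (ZMod.val_coe_unit_coprime u)
  have hcop' : IsCoprime (((u' : ZMod m).val : ℕ) : ℤ) (m : ℤ) :=
    Nat.isCoprime_iff_coprime.mpr (ZMod.val_coe_unit_coprime u')
  have hval : ((((u' : ZMod m).val : ℕ) : ℤ) : ZMod (Int.gcd (m : ℤ) N)) = (((u : ZMod m).val : ℕ) : ℤ) := by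
    rw [Int.gcd_natCast_natCast]
    have h' := congrArg (fun x : (ZMod (Nat.gcd m N))ˣ ↦ (x : ZMod (Nat.gcd m N))) h
    simp only [ZMod.unitsMap_def, Units.coe_map, MonoidHom.coe_coe, ZMod.castHom_apply] at h'
    rw [ZMod.cast_eq_val, ZMod.cast_eq_val] at h'
    push_cast
    exact h'
  have key := modularSymbol_sub_mem_periodLatticeGamma1_of_congr f hcop hcop' hm0 hm0 rfl hval
  push_cast at key ⊢
  exact key

/-! ### §2 Character sums over the fibres of `(ℤ/m)^× → (ℤ/gcd(m,N))^×` vanish when `χ` does not factor -/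

/-- If `χ mod m` does not factor through `d ∣ m`, then `Σ_{k ∈ ker((ℤ/m)^× → (ℤ/d)^×)} χ(k) = 0` (the restriction of `χ` to
the kernel is a nontrivial character of a finite group). [cite: WiersemaWuthrich2022, proof of Prop. 8 (p. 7)] -/
theorem sum_ker_unitsMap_eq_zero {m d : ℕ} [NeZero m] (hd : d ∣ m) (χ : DirichletCharacter ℂ m)
    (hχ : ¬ χ.FactorsThrough d) :
    ∑ k : (ZMod.unitsMap hd).ker, χ ((k : (ZMod m)ˣ) : ZMod m) = 0 := by
  rw [DirichletCharacter.factorsThrough_iff_ker_unitsMap hd] at hχ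
  -- the restriction of `χ` to the kernel, as a hom into `ℂ`
  set φ : (ZMod.unitsMap hd).ker →* ℂ :=
    (Units.coeHom ℂ).comp (χ.toUnitHom.comp (ZMod.unitsMap hd).ker.subtype) with hφ
  have hφ1 : φ ≠ 1 := by
    intro h1
    apply hχ
    intro x hx
    rw [MonoidHom.mem_ker]
    have hx1 : φ ⟨x, hx⟩ = 1 := by rw [h1]; rfl
    simp only [hφ, MonoidHom.comp_apply, Subgroup.coe_subtype, Units.coeHom_apply] at hx1
    exact Units.val_eq_one.mp hx1
  have h := sum_hom_units_eq_zero φ hφ1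
  simpa [hφ, MulChar.coe_toUnitHom] using h

/-! ### §3 THEOREM 93.C: `Σ_a χ(a){∞, a/m}_f ∈ ℤ[χ]·Λ₁(f)` when `χ` does not factor through `gcd(m, N)` -/

/-- **Twisted symbol sums off the level gcd are `Γ₁(N)`-integral** (E-es-364; Wiersema–Wuthrich 2022 Prop. 8 at the level
of `f`-periods, with NO Manin-constant hypothesis): if `χ mod m` does not factor through `(ℤ/gcd(m, N))^×` then
`twistedSymbolSum f χ ∈ Submodule.span ℤ {χ(c)·w : c ∈ ℤ/m, w ∈ Λ₁(f)}`.
[cite: WiersemaWuthrich2022, Prop. 8 (p. 7); f-period form = MEMO-es §93.4 THM 93.C, proved here] [cite: DiamondShurman2005, Prop. 3.8.3] -/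
theorem twistedSymbolSum_mem_span_periodLatticeGamma1 {m : ℕ} [NeZero m] (χ : DirichletCharacter ℂ m)
    (hχ : ¬ χ.FactorsThrough (Nat.gcd m N)) :
    twistedSymbolSum f χ ∈ Submodule.span ℤ {z : ℂ | ∃ c : ZMod m, ∃ w ∈ periodLatticeGamma1 f, z = χ c * w} := by
  have hd : Nat.gcd m N ∣ m := Nat.gcd_dvd_left m N
  haveI : NeZero (Nat.gcd m N) := ⟨(Nat.gcd_pos_of_pos_left N (Nat.pos_of_ne_zero (NeZero.ne m))).ne'⟩
  -- a section of `π = ZMod.unitsMap hd`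
  have hsurj : Function.Surjective (ZMod.unitsMap hd) := ZMod.unitsMap_surjective hd
  set s : (ZMod (Nat.gcd m N))ˣ → (ZMod m)ˣ := Function.surjInv hsurj with hs
  have hπs : ∀ v, ZMod.unitsMap hd (s v) = v := Function.surjInv_eq hsurj
  -- the symbol as a function of the unit, and its "class representative" version
  set G : (ZMod m)ˣ → ℂ := fun u ↦ modularSymbol f (((u : ZMod m).val : ℚ) / m) with hG
  set F : (ZMod (Nat.gcd m N))ˣ → ℂ := fun v ↦ modularSymbol f (((s v : ZMod m).val : ℚ) / m) with hF
  -- (1) non-units do not contribute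
  have h1 : twistedSymbolSum f χ = ∑ u : (ZMod m)ˣ, χ (u : ZMod m) * G u := by
    unfold twistedSymbolSum
    symm
    refine Finset.sum_bij_ne_zero (fun u _ _ ↦ (u : ZMod m)) (fun u _ _ ↦ Finset.mem_univ _)
      (fun u₁ _ _ u₂ _ _ h ↦ Units.ext h) (fun a _ ha ↦ ?_) (fun u _ _ ↦ rfl)
    have hu : IsUnit a := by
      by_contra hna
      exact ha (by rw [MulChar.map_nonunit χ hna, zero_mul])
    exact ⟨hu.unit, Finset.mem_univ _, by rw [hu.unit_spec]; exact ha, hu.unit_spec⟩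
  -- (2) replace each symbol by the symbol of its class representative, up to `Λ₁(f)`
  have h2 : ∀ u : (ZMod m)ˣ, G u - F (ZMod.unitsMap hd u) ∈ periodLatticeGamma1 f := by
    intro u
    exact modularSymbol_units_sub_mem_periodLatticeGamma1 f (s (ZMod.unitsMap hd u)) u (by rw [hπs])
  -- (3) the representative sum vanishes: reindex `(ℤ/m)^× ≃ (ℤ/gcd)^× × ker`
  have h3 : ∑ u : (ZMod m)ˣ, χ (u : ZMod m) * F (ZMod.unitsMap hd u) = 0 := by
    have hmemK : ∀ u : (ZMod m)ˣ, (s (ZMod.unitsMap hd u))⁻¹ * u ∈ (ZMod.unitsMap hd).ker := by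
      intro u; rw [MonoidHom.mem_ker, map_mul, map_inv, hπs, inv_mul_cancel]
    let e : (ZMod (Nat.gcd m N))ˣ × (ZMod.unitsMap hd).ker ≃ (ZMod m)ˣ :=
      { toFun := fun vk ↦ s vk.1 * (vk.2 : (ZMod m)ˣ)
        invFun := fun u ↦ (ZMod.unitsMap hd u, ⟨(s (ZMod.unitsMap hd u))⁻¹ * u, hmemK u⟩)
        left_inv := by
          rintro ⟨v, k, hk⟩
          have hv : ZMod.unitsMap hd (s v * k) = v := by
            rw [map_mul, hπs, (MonoidHom.mem_ker).mp hk, mul_one]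
          refine Prod.ext hv (Subtype.ext ?_)
          dsimp only
          rw [hv, inv_mul_cancel_left]
        right_inv := fun u ↦ by dsimp only; rw [mul_inv_cancel_left] }
    rw [← Fintype.sum_equiv e _ _ (fun _ ↦ rfl), Fintype.sum_prod_type]
    refine Finset.sum_eq_zero fun v _ ↦ ?_
    have hrow : ∀ k : (ZMod.unitsMap hd).ker,
        χ ((e (v, k) : (ZMod m)ˣ) : ZMod m) * F (ZMod.unitsMap hd (e (v, k))) =
          F v * χ ((s v : (ZMod m)ˣ) : ZMod m) * χ ((k : (ZMod m)ˣ) : ZMod m) := by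
      intro k
      have hv : ZMod.unitsMap hd (e (v, k)) = v := by
        show ZMod.unitsMap hd (s v * (k : (ZMod m)ˣ)) = v
        rw [map_mul, hπs, (MonoidHom.mem_ker).mp k.2, mul_one]
      rw [hv]
      show χ (((s v * (k : (ZMod m)ˣ) : (ZMod m)ˣ) : ZMod m)) * F v = _
      rw [Units.val_mul, map_mul]; ring
    rw [Fintype.sum_congr _ _ hrow, ← Finset.mul_sum, sum_ker_unitsMap_eq_zero hd χ hχ, mul_zero]
  -- assemble
  have hsplit : twistedSymbolSum f χ =
      ∑ u : (ZMod m)ˣ, χ (u : ZMod m) * F (ZMod.unitsMap hd u) +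
        ∑ u : (ZMod m)ˣ, χ (u : ZMod m) * (G u - F (ZMod.unitsMap hd u)) := by
    rw [h1, ← Finset.sum_add_distrib]
    exact Finset.sum_congr rfl fun u _ ↦ by ring
  rw [hsplit, h3, zero_add]
  refine Submodule.sum_mem _ fun u _ ↦ Submodule.subset_span ?_
  exact ⟨(u : ZMod m), G u - F (ZMod.unitsMap hd u), h2 u, rfl⟩

/-- **E-es-364 `TwistedSymbolSumIntegralOffGcd`** — verbatim the `Prop` typed by es g64 (`Sketch-es-g64.lean`), now a
theorem.  With es g64's proved glue `neron_of_gamma1` and the tree's `Λ₁(f) ⊆ Λ_W` it yields Wiersema–Wuthrich 2022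
Thm. 2(a) / Cor. 3 in lattice form for every curve of the isogeny class without their `c₁ = 1` hypothesis.
[cite: WiersemaWuthrich2022, Prop. 8 (p. 7); f-period form proved here] -/
theorem twistedSymbolSumIntegralOffGcd :
    ∀ (N : ℕ) [NeZero N] (f : CuspForm (Gamma0 N) 2) (m : ℕ) [NeZero m] (χ : DirichletCharacter ℂ m),
      ¬ χ.FactorsThrough (Nat.gcd m N) →
        twistedSymbolSum f χ ∈ Submodule.span ℤ {z : ℂ | ∃ c : ZMod m, ∃ w ∈ periodLatticeGamma1 f, z = χ c * w} :=
  fun _ _ f _ _ χ hχ ↦ twistedSymbolSum_mem_span_periodLatticeGamma1 f χ hχ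

end Literature.NumberTheory.EllipticCurves.ModularForms

end
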